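/-
Copyright: statement-level skeleton of a published paper (lit-balaban cell, Phase-2 proof seat p19, gen 5). No claims beyond
what the kernel checks below.
-/
import Mathlib
import Literature.MathematicalPhysics.QuantumFieldTheory.Balaban1983to89.B3IBPZeroBox

/-!
# B3 — T. Bałaban, *(Higgs)₂,₃ quantum fields in a finite volume. III. Renormalization*, CMP **88** (1983) 411–445
[Balaban1983Higgs3] — the graph (2.4) p. 424 in the ZERO-FIELD BOX CLASS: its amplitude with the genuine differenced propagator,
the printed hypothesis of Proposition 2.1 through the exception clause, and (1.33) for it in every dimension

statement-level skeleton of published theorems with citation tags; proofs where landed; nothing here is a claim about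
the Yang–Mills mass gap

PDF held: `paper:balaban1983-higgs-2-3-quantum-fields-finite-volume` (journal page = PDF page + 410); p. 413 [PDF 3] (1.8), p. 424
[PDF 14] (2.4) and Proposition 2.1, read on the materialised text (`lit read … --pages 12-18`).

Part of the Phase-2 work on SKELETON rows **B3.Prop2.1 / B3.Eq2.4** (unit `lit-balaban-p19` gen 5, HOME
`run/shared/lean/pub/lit-balaban/`): the end-to-end witness of the chain `B3AmpIBPSingle` → `B3Prop21Except24Single` →
`B3IBPZeroBoxKernels` → `B3IBPZeroBox` (Proposition 2.1 with the (2.4) exception for the zero-field box class, IBP-readiness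
discharged).  Own namespace; definitions with bodies (`zb24`, `member24`) and theorems; nothing existing is modified.

WHAT IS REPRODUCED.  p. 424 [PDF 14], verbatim: *"To have not too much restricted formulation of this theorem, let us introduce
the following special graph with a degree equal to 0: (2.4)"* — two vertices (1.8) (`n + n′ = 1`, p. 413: the leg
`(D^η_{B̃,μ}φ′)(b)`), joined by one scalar line carrying BOTH derivative legs (the reading of seat p18's `B3Graph24Unique.graph24_unique`
and of gen 4's `B3Prop21Except24Example.graph24`) — and *"Proposition 2.1. Let G be a connected graph such that its each connected
subgraph, with the possible exception of the subgraphs (2.4), has a positive degree. Then … Proposition 1 holds in this case."*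
KERNEL-CHECKED HERE, in the zero-field box class of `B3IBPZeroBox` and in EVERY dimension `d + 1`: the graph (2.4) `zb24` (vertex
`0` differentiates the first leg of the line, vertex `1` the second leg; directions arbitrary); its line kernel in the amplitude
`iboxAmp` IS the mixed difference quotient `∂⁺_{μ,x}∂⁺_{ν,y}[ζ(x)ζ(y)η^{−(d+1)}G^η_{(t)}(□,0;x,y)]` of the cut-off zero-field box piece
(`amp_K_zb24`); its degree (2.2) is `0` in every dimension (`degQ_zb24`: `2(d+1) − (d+1) + (2 − (d+1) − 2) = 0`), it IS a (2.4)-block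
(`is24Block_zb24`), so the PRINTED hypothesis of Proposition 2.1 holds for it through the exception clause
(`posSubgraphsExcept24_member24`) while the exception-free positivity fails (`not_posSubgraphs_member24`); and **(1.33) for the
amplitudes of (2.4) in the zero box** in the quantifier shape of Proposition 1, for every datum (scale, window point, box,
couplings, vertex data), by `prop21_zeroBox` — i.e. after the integration by parts (2.8) at the vertex `0`, performed by the
machinery on the genuine kernel (`ineq133At_member24`).  Scope as in `B3IBPZeroBox` (A = B̃ = 0, Ω = □; vertex side data).
-/

open Finset

namespace Literature.MathematicalPhysics.QuantumFieldTheory.Balaban1983to89.B3IBPZeroBoxGraph24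

open Literature.MathematicalPhysics.QuantumFieldTheory.Balaban1983to89.B3Ineq215
open Literature.MathematicalPhysics.QuantumFieldTheory.Balaban1983to89.B3Ineq213
open Literature.MathematicalPhysics.QuantumFieldTheory.Balaban1983to89.B3Ineq213ZeroBoxLines (twoVertexGraph)
open Literature.MathematicalPhysics.QuantumFieldTheory.Balaban1983to89.B3IBPZeroBoxKernels
open Literature.MathematicalPhysics.QuantumFieldTheory.Balaban1983to89.B3IBPZeroBox
open B3Sect2FirstEstimate B3Prop1

noncomputable section

/-! ## §1 The graph (2.4) with its two derivative legs -/

/-- **The graph (2.4) in the zero-field box class**: two vertices `0, 1` ((1.8) with `n + n′ = 1`, η-power `0`), one scalar line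
`0 → 1`; the derivative leg of the vertex `0` is the first leg of the line (direction `μ`), that of the vertex `1` its second leg
(direction `ν`). [cite: Balaban1983Higgs3, (2.4) p.424] -/
def zb24 (d : ℕ) (μ ν : Fin (d + 1)) : SDGraph (Fin 2) 1 d where
  toLineGraph := twoVertexGraph
  der := fun v => if v = 0 then some (0, true) else some (0, false)
  dir := fun v => if v = 0 then μ else ν
  der_at := fun v l e h => by
    fin_cases v
    · simp only [Fin.zero_eta, Fin.isValue, if_true, Option.some.injEq, Prod.mk.injEq] at h
      rw [← h.2]; rfl
    · simp only [Fin.mk_one, Fin.isValue, one_ne_zero, if_false, Option.some.injEq, Prod.mk.injEq] at h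
      rw [← h.2]; rfl

variable {d : ℕ} (μ ν : Fin (d + 1))

/-- The first leg of the line carries the derivative of the vertex `0`. [cite: Balaban1983Higgs3, (2.4) p.424] -/
theorem DS_zb24 : (zb24 d μ ν).DS 0 := by
  unfold SDGraph.DS zb24; simp [twoVertexGraph]

/-- The second leg of the line carries the derivative of the vertex `1`. [cite: Balaban1983Higgs3, (2.4) p.424] -/
theorem DT_zb24 : (zb24 d μ ν).DT 0 := by
  unfold SDGraph.DT zb24; simp [twoVertexGraph]

variable (ℓ : ℕ) (hℓ : 1 ≤ ℓ) (amin aplus m2plus : ℝ) (ha : 0 < amin)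

/-- The count datum of (2.4): both endpoints differentiate the line once. [cite: Balaban1983Higgs3, (2.1) p.422] -/
theorem diffOn_zb24 (v : Fin 2) : (zbCounts (zb24 d μ ν) ℓ hℓ amin aplus m2plus ha).diffOn v 0 = 1 := by
  rw [zbCounts_diffOn, if_pos (DS_zb24 μ ν), if_pos (DT_zb24 μ ν)]
  fin_cases v <;> simp [zb24, twoVertexGraph]

/-- After shrinking the only line both vertices lie in the block of the first endpoint `0`. [cite: Balaban1983Higgs3, (2.16) p.428] -/
theorem rep_one_zb24 (v : Fin 2) : (zbCounts (zb24 d μ ν) ℓ hℓ amin aplus m2plus ha).toModel.rep 1 v = 0 := by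
  rw [(zbCounts (zb24 d μ ν) ℓ hℓ amin aplus m2plus ha).toModel.rep_succ Nat.zero_lt_one v]
  unfold Model.rho Model.bs Model.bt
  simp only [Model.rep_zero]
  fin_cases v <;> simp [zbCounts, B3Ineq213ZeroBoxDiffLines.dboxCounts, SDGraph.toDLineGraph, zb24, twoVertexGraph,
    Counts.toModel]

/-- The block `G₁` of (2.4) is the whole vertex set. [cite: Balaban1983Higgs3, (2.16) p.428] -/
theorem fiber_one_zb24 : (zbCounts (zb24 d μ ν) ℓ hℓ amin aplus m2plus ha).toModel.fiber 1 0 = univ := by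
  ext v; simp [Model.mem_fiber, rep_one_zb24]

/-- Its line set is the single line `0`. [cite: Balaban1983Higgs3, (2.16) p.428] -/
theorem before_one_zb24 : (zbCounts (zb24 d μ ν) ℓ hℓ amin aplus m2plus ha).toModel.before 1 0 = {0} := by
  ext l
  simp only [Model.mem_before, rep_one_zb24, and_true, mem_singleton, Fin.eq_zero l, Fin.val_zero, Nat.zero_lt_one]

/-- **`a = 2 − (d+1) − 2 = −(d+1)`**: two scalar legs and two differentiations. [cite: Balaban1983Higgs3, (2.14) p.427] -/
theorem lineDimQ_zb24 : lineDimQ (zbCounts (zb24 d μ ν) ℓ hℓ amin aplus m2plus ha) 0 = -((d : ℚ) + 1) := by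
  have hd : ((zbCounts (zb24 d μ ν) ℓ hℓ amin aplus m2plus ha).d : ℚ) = (d : ℚ) + 1 := by
    simp [zbCounts, B3Ineq213ZeroBoxDiffLines.dboxCounts]
  have hv : ∀ v : Fin 2, ((zbCounts (zb24 d μ ν) ℓ hℓ amin aplus m2plus ha).vecLegAvg v 0 : ℚ) = 0 := fun v => by
    simp [zbCounts, B3Ineq213ZeroBoxDiffLines.dboxCounts]
  have hl : ∀ v : Fin 2, ((zbCounts (zb24 d μ ν) ℓ hℓ amin aplus m2plus ha).legsOn v 0 : ℚ) = 1 := fun v => by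
    unfold Counts.legsOn
    fin_cases v <;> simp [zbCounts, B3Ineq213ZeroBoxDiffLines.dboxCounts, SDGraph.toDLineGraph, zb24, twoVertexGraph]
  unfold lineDimQ legExpQ
  simp only [Fin.sum_univ_two, hd, hv, hl, diffOn_zb24, Nat.cast_one]
  ring

/-- **"a degree equal to 0" in every dimension**: `D((2.4)) = 2(d+1) − (d+1) − (d+1) = 0` by (2.2). [cite: Balaban1983Higgs3, (2.4) p.424] -/
theorem degQ_zb24 : degQ (zbCounts (zb24 d μ ν) ℓ hℓ amin aplus m2plus ha) 1 0 = 0 := by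
  unfold degQ
  rw [fiber_one_zb24, before_one_zb24, sum_singleton, lineDimQ_zb24]
  simp [zbCounts, B3Ineq213ZeroBoxDiffLines.dboxCounts, SDGraph.toDLineGraph, zb24, twoVertexGraph]
  ring

/-- **(2.4) is a (2.4)-block** (`Is24Block`: degree `0`, one line with two endpoints and a derivative of its first endpoint on it).
[cite: Balaban1983Higgs3, (2.4) p.424] -/
theorem is24Block_zb24 : Is24Block (zbCounts (zb24 d μ ν) ℓ hℓ amin aplus m2plus ha) 1 0 :=
  ⟨degQ_zb24 μ ν ℓ hℓ amin aplus m2plus ha, 0, by show (0 : Fin 2) ≠ 1; decide,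
    by rw [diffOn_zb24], before_one_zb24 μ ν ℓ hℓ amin aplus m2plus ha⟩

/-- The exception-free positivity fails for (2.4). [cite: Balaban1983Higgs3, Prop. 2.1 p.424] -/
theorem not_pos_zb24 : ¬ 0 < degQ (zbCounts (zb24 d μ ν) ℓ hℓ amin aplus m2plus ha) 1 0 := by
  rw [degQ_zb24]; exact lt_irrefl 0

/-! ## §2 (2.4) as a member of the family of the zero-field box class -/

variable (P : ParamsZB) (μ' ν' : Fin (P.d + 1))

/-- The count datum of (2.4) with the lattice constants of the family `P`. [cite: Balaban1983Higgs3, (2.4) p.424] -/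
def G24 : Counts (Fin 2) 1 := zbCounts (zb24 P.d μ' ν') P.ℓ P.hℓ P.amin P.aplus P.m2plus P.ha

/-- **(2.4) is a graph of the expansion** at every size bound `mb ≥ 1`. [cite: Balaban1983Higgs3, Prop. 2.1 p.424] -/
def member24 {mb : ℕ} (h : 1 ≤ mb) : CGraphZB P mb where
  n := 2
  m := 1
  m_le := h
  Γ := zb24 P.d μ' ν'

/-- The count datum of the member is `G24`. [cite: Balaban1983Higgs3, (2.4) p.424] -/
theorem member24_counts {mb : ℕ} (h : 1 ≤ mb) : (member24 P μ' ν' h).counts = G24 P μ' ν' := rfl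

/-- Block representatives of `G24` after the only line. [cite: Balaban1983Higgs3, (2.16) p.428] -/
theorem rep_one_G24 (v : Fin 2) : (G24 P μ' ν').toModel.rep 1 v = 0 :=
  rep_one_zb24 μ' ν' P.ℓ P.hℓ P.amin P.aplus P.m2plus P.ha v

/-- The line set of the block of `G24`. [cite: Balaban1983Higgs3, (2.16) p.428] -/
theorem before_one_G24 : (G24 P μ' ν').toModel.before 1 0 = {0} :=
  before_one_zb24 μ' ν' P.ℓ P.hℓ P.amin P.aplus P.m2plus P.ha

/-- The degree of `G24` is `0`. [cite: Balaban1983Higgs3, (2.4) p.424] -/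
theorem degQ_G24 : degQ (G24 P μ' ν') 1 0 = 0 :=
  degQ_zb24 μ' ν' P.ℓ P.hℓ P.amin P.aplus P.m2plus P.ha

/-- `G24` is a (2.4)-block. [cite: Balaban1983Higgs3, (2.4) p.424] -/
theorem is24Block_G24 : Is24Block (G24 P μ' ν') 1 0 :=
  is24Block_zb24 μ' ν' P.ℓ P.hℓ P.amin P.aplus P.m2plus P.ha

/-- A one-line graph has one ordering: relabelling along a permutation of `Fin 1` does nothing. [cite: Balaban1983Higgs3, (2.7) p.424] -/
theorem relabelCounts_G24 (σ : Equiv.Perm (Fin 1)) : relabelCounts (G24 P μ' ν') σ = G24 P μ' ν' := by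
  rw [Subsingleton.elim σ (Equiv.refl _)]
  rfl

/-- **The line of the amplitude of (2.4) IS the mixed difference quotient of the cut-off zero-field box piece**:
`K(t; x, y) = ∂⁺_{μ,x}∂⁺_{ν,y}[ζ(x)ζ(y)η^{−(d+1)}G^η_{(t)}(□,0;x,y)]`. [cite: Balaban1983Higgs3, (2.4) p.424, (2.10) p.426] -/
theorem amp_K_zb24 {mb : ℕ} (h : 1 ≤ mb) (D : DatumZB P) (box : Fin 2 → Fin (P.d + 1) → ℕ) :
    (D.amp (member24 P μ' ν' h) box).K (0 : Fin 1)
      = fdX (s₀ P.ℓ D.k) μ' (fdY (s₀ P.ℓ D.k) ν' (cutK P.ℓ D.k D.M D.a D.m2)) := by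
  show zbK (zb24 P.d μ' ν') P.ℓ D.k D.M D.a D.m2 0 = _
  unfold zbK zbKb
  rw [if_pos (DS_zb24 μ' ν'), if_pos (DT_zb24 μ' ν')]
  rfl

/-- **The PRINTED hypothesis of Proposition 2.1 holds for (2.4)** in the family — through the exception clause: its only connected
subgraph (the block of `G₁ = G` along the only ordering) is the (2.4)-block, of degree `0`. [cite: Balaban1983Higgs3, Prop. 2.1 p.424] -/
theorem posSubgraphsExcept24_member24 {mb : ℕ} (h : 1 ≤ mb) (D : DatumZB P) :
    PosSubgraphsExcept24 (expansionZB P mb D) (member24 P μ' ν' h) := by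
  refine ⟨trivial, ?_⟩
  show ∀ H : Component (G24 P μ' ν'),
    Is24Block (relabelCounts (G24 P μ' ν') H.1) H.2.1 H.2.2.1 ∨ 0 < degQ (relabelCounts (G24 P μ' ν') H.1) H.2.1 H.2.2.1
  rintro ⟨σ, i, b, hb, hn⟩
  left
  change Is24Block (relabelCounts (G24 P μ' ν') σ) i b
  rw [relabelCounts_G24] at hb hn ⊢
  have hi : (i : ℕ) = 0 ∨ (i : ℕ) = 1 := by have := i.isLt; omega
  rcases hi with hi | hi <;> rw [hi] at hb hn ⊢
  · exact absurd hn (by simp [Model.Nontriv, Model.before_zero])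
  · have hb0 : b = 0 := by
      have := (G24 P μ' ν').toModel.mem_reps.1 hb
      rw [rep_one_G24] at this
      exact this.symm
    subst hb0
    exact is24Block_G24 P μ' ν'

/-- … while the exception-free positivity hypothesis fails for this member (its block has degree `0`).
[cite: Balaban1983Higgs3, Prop. 2.1 p.424] -/
theorem not_posSubgraphs_member24 {mb : ℕ} (h : 1 ≤ mb) (D : DatumZB P) :
    ¬ ∀ H : (expansionZB P mb D).Sub (member24 P μ' ν' h), 0 < (expansionZB P mb D).subDeg (member24 P μ' ν' h) H := by
  intro hall
  change ∀ H : Component (G24 P μ' ν'), 0 < degQ (relabelCounts (G24 P μ' ν') H.1) H.2.1 H.2.2.1 at hall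
  have hrep : (0 : Fin 2) ∈ (relabelCounts (G24 P μ' ν') 1).toModel.reps ((1 : Fin 2) : ℕ) := by
    rw [relabelCounts_G24, Model.mem_reps]; exact rep_one_G24 P μ' ν' 0
  have hnt : (relabelCounts (G24 P μ' ν') 1).toModel.Nontriv ((1 : Fin 2) : ℕ) 0 := by
    rw [relabelCounts_G24]
    change ((G24 P μ' ν').toModel.before 1 0).Nonempty
    rw [before_one_G24]; exact singleton_nonempty 0
  have h1 := hall ⟨1, 1, 0, hrep, hnt⟩
  change 0 < degQ (relabelCounts (G24 P μ' ν') 1) ((1 : Fin 2) : ℕ) 0 at h1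
  rw [relabelCounts_G24, Fin.val_one, degQ_G24] at h1
  exact lt_irrefl 0 h1

/-! ## §3 (1.33) for the graph (2.4) in the zero box -/

/-- **(1.33) for the amplitudes of the graph (2.4) in the zero-field box class**, from `prop21_zeroBox` through the exception
clause, in the quantifier shape of Proposition 1: `∃ δ₀ > 0, ∀ α₀ ∈ (0,1), ∀ n̄, ∃ O(1) > 0`, for EVERY datum (scale `k ≥ 1`, window
point, box, couplings, vertex data) — the line being the genuine doubly differenced cut-off propagator piece, on which the machinery
performs the integration by parts (2.8) at the vertex `0`. [cite: Balaban1983Higgs3, Prop. 2.1 p.424] -/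
theorem ineq133At_member24 (mbar : ℕ → ℕ) :
    ∃ δ₀ : ℝ, 0 < δ₀ ∧ ∀ α₀ : ℝ, 0 < α₀ → α₀ < 1 → ∀ nbar : ℕ, ∃ C : ℝ, 0 < C ∧
      ∀ (D : DatumZB P) (h : 1 ≤ mbar nbar),
        Ineq133At (famZB P mbar nbar D).toExpansion (member24 P μ' ν' h) α₀ δ₀ C := by
  obtain ⟨δ₀, hδ, H⟩ := prop21_zeroBox P mbar
  refine ⟨δ₀, hδ, fun α₀ h0 h1 nbar => ?_⟩
  obtain ⟨C, hC, HC⟩ := H α₀ h0 h1 nbar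
  exact ⟨C, hC, fun D h => HC D (member24 P μ' ν' h) (posSubgraphsExcept24_member24 P μ' ν' h D)⟩

/-- The same, unfolded: for every datum and localization, `|E((2.4), {□(v)})| ≤ O(1)·e^{Σd_v}λ^{Σd_s}e^{−δ₀d({□(v)})}Π N^Φ_v Π N^A_v`
with `E` the total amplitude of `iboxAmp` — the lattice sum with the genuine differenced propagator pieces.
[cite: Balaban1983Higgs3, (1.33) p.420, Prop. 2.1 p.424] -/
theorem abs_Etot_member24_le (mbar : ℕ → ℕ) :
    ∃ δ₀ : ℝ, 0 < δ₀ ∧ ∀ α₀ : ℝ, 0 < α₀ → α₀ < 1 → ∀ nbar : ℕ, ∃ C : ℝ, 0 < C ∧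
      ∀ (D : DatumZB P) (h : 1 ≤ mbar nbar) (box : Fin 2 → Fin (P.d + 1) → ℕ),
        |(D.amp (member24 P μ' ν' h) box).toAmp.Etot|
          ≤ C * D.eRun ^ (∑ v, (D.vtx (zb24 P.d μ' ν') boxZ).dv v) * D.lamRun ^ (∑ v, (D.vtx (zb24 P.d μ' ν') boxZ).ds v)
            * Real.exp (-(δ₀ * boxTreeLen (P.ℓ + 1) D.k box))
            * (∏ v, (D.vtx (zb24 P.d μ' ν') box).NPhi v) * (∏ v, (D.vtx (zb24 P.d μ' ν') box).NA v) := by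
  obtain ⟨δ₀, hδ, H⟩ := ineq133At_member24 P μ' ν' mbar
  refine ⟨δ₀, hδ, fun α₀ h0 h1 nbar => ?_⟩
  obtain ⟨C, hC, HC⟩ := H α₀ h0 h1 nbar
  exact ⟨C, hC, fun D h box => HC D h box () ()⟩

end

end Literature.MathematicalPhysics.QuantumFieldTheory.Balaban1983to89.B3IBPZeroBoxGraph24
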